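import Summits.QuantumAdvantage.QuantumAdvantage.Theorems.CubicForrelationNearExactIsExactRothaus

/-!
# Crux `CubicForrelation.NearExactIsExact` (stmt-QuantumAdvantage-14043), line `direct-sum-amplification` —
stub T: the 2-adic Walsh tower (`stub_walshTower`)

In the tree's `Bool` / `IsDegLeFun` / `W` vocabulary. GIVEN Ax's parity theorem on coordinate cubes (the hypothesis
`hAx`, verbatim the statement of the landed `stub_axParity`: for `h` of degree `≤ d`, `d ≥ 1`,
`Σ_{x ∈ E_K} (−1)^{h(x)} ∈ 2^{⌈|K|/d⌉} ℤ`): if `g` is CUBIC on `n` bits and every Walsh value is divisible by `2^j`,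
`W_g(x) = 2^j · u(x)` with `u(x) ∈ ℤ` (`W_g(x) = Σ_y (−1)^{g(y)} (−1)^{y·x}`), then the parity function
`x ↦ [u(x) odd]` has algebraic degree `≤ d` as soon as `j + 1 ≤ k + ⌈(n − k)/3⌉` for every `k` with `d < k ≤ n`
(`⌈(n − k)/3⌉ = (n − k + 2)/3` in `ℕ`). The case `j = m + 1` of a bent `g` on `m + m` bits is Hou's bound
(`stub_houCubic`); walking `j` down gives the "2-adic Walsh tower" of the line file (§4f).

Proof (Rothaus' parity method — Carlet 2021 Thm 13 / MacWilliams–Sloane Ch. 14 §5 — at the 2-adic level `j`).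
By binary Möbius inversion (`bb_moebius_isDegLeFun`) it suffices that `#{x ∈ E_I : u(x) odd}` is even for every
coordinate set `I` with `|I| > d` (`E_I = {x : supp x ⊆ I}`, written `{x | ∀ i, x i = true → i ∈ I}`). POISSON
(`bb_poisson` with `G = (−1)^g`, `J = I`): `Σ_{x ∈ E_I} W_g(x) = 2^{|I|} Σ_{y ∈ E_{Iᶜ}} (−1)^{g(y)}`, and AX on the
complementary cube (`K = Iᶜ`, `d = 3`, `|Iᶜ| = n − |I|`) writes the cube bias as `2^c z` with `c = ⌈(n − |I|)/3⌉`.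
Hence `2^j Σ_{x ∈ E_I} u(x) = 2^{|I| + c} z` in `ℤ`, and `|I| + c ≥ j + 1` (the side condition at `k = |I|`), so
`Σ_{x ∈ E_I} u(x)` is EVEN; a sum of integers is even iff the number of odd summands is even (cast to `𝔽₂`:
`tw_even_sum_iff`).

Sources: J. Ax, *Zeroes of polynomials over finite fields*, Amer. J. Math. 86 (1964) (the divisibility, here a
hypothesis); O. S. Rothaus, *On "bent" functions*, JCTA 20 (1976); C. Carlet, *Boolean Functions for Cryptography and
Coding Theory*, CUP 2021, §2.2 (binary Möbius transform) and Thm 13; X.-D. Hou, *Cubic bent functions*, Discrete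
Math. 189 (1998). Everything below is proved from Mathlib and the tree (`bb_poisson`, `bb_moebius_isDegLeFun`);
axioms are the standard three. Imports: the Rothaus file only; the Theses file is deliberately NOT imported.
-/

set_option linter.dupNamespace false -- D-0017: single-problem summit ⇒ `QuantumAdvantage.QuantumAdvantage` by design

noncomputable section

namespace Summit.QuantumAdvantage.QuantumAdvantage.Theorems.CubicForrelation.NearExactIsExact

open Finset
open Literature.Computability.QuantumComplexity
open Literature.Computability.QuantumComplexity.DerivativeWalsh (W)

/-- An integer reduces to `1` in `𝔽₂` if it is odd and to `0` otherwise. -/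
theorem tw_intCast_zmod_two (a : ℤ) : (a : ZMod 2) = if Odd a then 1 else 0 := by
  split_ifs with h
  · exact ZMod.intCast_eq_one_iff_odd.2 h
  · exact ZMod.intCast_eq_zero_iff_even.2 (Int.not_odd_iff_even.1 h)

/-- A sum of integers is even iff the number of odd summands is even (reduce modulo `2`). -/
theorem tw_even_sum_iff {α : Type*} (s : Finset α) (u : α → ℤ) :
    Even (∑ x ∈ s, u x) ↔ Even #(s.filter fun x => Odd (u x)) := by
  rw [← ZMod.intCast_eq_zero_iff_even, ← ZMod.natCast_eq_zero_iff_even, Int.cast_sum,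
    sum_congr rfl fun x _ => tw_intCast_zmod_two (u x), sum_boole]

/-- The arithmetic of the evenness step: if `j + 1 ≤ i + c` and `2^j S = 2^i (2^c z)` in `ℤ`, then `S` is even
(`S = 2^{i + c − j} z`). -/
theorem tw_even_of_balance {j i c : ℕ} {S z : ℤ} (hjc : j + 1 ≤ i + c)
    (h : (2 : ℤ) ^ j * S = 2 ^ i * (2 ^ c * z)) : Even S := by
  obtain ⟨e, he⟩ : ∃ e, i + c = j + (e + 1) := ⟨i + c - (j + 1), by omega⟩
  refine ⟨2 ^ e * z, ?_⟩
  have h0 : (2 : ℤ) ^ j ≠ 0 := by positivity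
  apply mul_left_cancel₀ h0
  rw [h, ← mul_assoc, ← pow_add, he]
  ring

/-- **stub_walshTower** (T; the 2-adic Walsh tower — Ax–Poisson–Möbius at the 2-adic level `j`). GIVEN Ax's parity
theorem on coordinate cubes (`hAx`, the statement of `stub_axParity`): if `g` is cubic on `n` bits and
`W_g(x) = 2^j · u(x)` with `u(x) ∈ ℤ` for every `x`, then the parity function `x ↦ [u(x) odd]` has algebraic degree
`≤ d` as soon as `j + 1 ≤ k + (n − k + 2)/3` for every `k` with `d < k ≤ n`. Proof: for every coordinate set `I` with
`|I| > d`, Poisson summation over `E_I` (`bb_poisson`) and Ax's theorem on `E_{Iᶜ}` (`d = 3`) give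
`2^j Σ_{x ∈ E_I} u(x) = 2^{|I| + ⌈(n−|I|)/3⌉} z`, so `Σ_{x ∈ E_I} u(x)` is even (`tw_even_of_balance`), hence so is
`#{x ∈ E_I : u(x) odd}` (`tw_even_sum_iff`); conclude by Möbius inversion (`bb_moebius_isDegLeFun`). -/
theorem stub_walshTower :
    (∀ (n d : ℕ) (h : (Fin n → Bool) → Bool) (K : Finset (Fin n)), 1 ≤ d → IsDegLeFun d h →
      ∃ z : ℤ, ∑ x ∈ {u : Fin n → Bool | ∀ i, u i = true → i ∈ K}, signOf (h x) =
        (2 : ℝ) ^ ((K.card + d - 1) / d) * (z : ℝ)) →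
    ∀ (n j d : ℕ) (g : (Fin n → Bool) → Bool) (u : (Fin n → Bool) → ℤ), IsDegLeFun 3 g →
      (∀ x, W (fun y => signOf (g y)) x = (2 : ℝ) ^ j * (u x : ℝ)) →
      (∀ k, d < k → k ≤ n → j + 1 ≤ k + (n - k + 2) / 3) →
      IsDegLeFun d (fun x => decide (Odd (u x))) := by
  intro hAx n j d g u hg hu hside
  refine bb_moebius_isDegLeFun d (fun x => decide (Odd (u x))) fun I hI => ?_
  have hP := bb_poisson (fun y => signOf (g y)) I
  obtain ⟨z, hz⟩ := hAx n 3 g Iᶜ (by norm_num) hg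
  generalize hc : (Iᶜ.card + 3 - 1) / 3 = c at hz
  rw [sum_congr rfl fun x _ => hu x, ← mul_sum, hz] at hP
  have hk : #I ≤ n := (card_le_univ I).trans_eq (Fintype.card_fin n)
  have hj : #Iᶜ = n - #I := by rw [card_compl, Fintype.card_fin]
  have hjc : j + 1 ≤ #I + c := by
    have h := hside #I hI hk
    omega
  have hZ : (2 : ℤ) ^ j * ∑ x ∈ {x : Fin n → Bool | ∀ i, x i = true → i ∈ I}, u x = 2 ^ #I * (2 ^ c * z) := by
    have h' : (((2 : ℤ) ^ j * ∑ x ∈ {x : Fin n → Bool | ∀ i, x i = true → i ∈ I}, u x : ℤ) : ℝ) =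
        (((2 : ℤ) ^ #I * (2 ^ c * z) : ℤ) : ℝ) := by
      push_cast
      exact hP
    exact_mod_cast h'
  have hE := (tw_even_sum_iff _ u).1 (tw_even_of_balance hjc hZ)
  rw [filter_filter] at hE
  simpa only [decide_eq_true_eq] using hE

end Summit.QuantumAdvantage.QuantumAdvantage.Theorems.CubicForrelation.NearExactIsExact
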